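import Summits.Ventures.WeilGRH.CharacterFamilyFlatTest
import HarnessLib

/-!
# GRH arm (rh-explicit, venture WeilGRH): the flat-window inequality over a SUBGROUP of characters —
  every abelian field of conductor dividing `q`

Cell `rh-explicit`, WEIL TRACK (structure seat weil-3, gen8).  `CharacterFamilyFlatTest.lean` summed the
flat-window inequalities over ALL characters mod `q` (the cyclotomic field `ℚ(ζ_q)`) and
`CharacterFamilyProgressions.lean` over the EVEN ones (`ℚ(ζ_q)⁺`).  Here the family is any finite set `s`
of Dirichlet characters mod `q` closed under multiplication and containing `1` — a subgroup `H` of the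
character group, i.e. (by class field theory over `ℚ`, not used here) the character group of an arbitrary
ABELIAN number field `K_H` of conductor dividing `q`.  Orthogonality for `H` (`sum_char_eq_of_mulClosed`:
`Σ_{χ∈H} χ(x) = |H|·𝟙[χ(x) = 1 ∀ χ ∈ H]`, proved by the translation trick inside `s`) gives

* `subgroupFamily_flatWindow_le`: `ζ` rung at `a` ∧ `WeilPositivityOnChar χ a` for every `χ ∈ H ∖ {1}` ⟹
  `2|H|·Σ_{log n<2a, n ∈ H^⊥} Λ(n)n^{-1/2}(1 − log n/(2a)) + Σ_{χ∈H}(K_{κ(χ)} − I_{κ(χ)}(a)/a)`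
  `≤ (|H| − 1)·log q + 16 sinh²(a/2)/a`,
  where `n ∈ H^⊥` means `χ(n) = 1` for all `χ ∈ H` — the prime powers splitting completely in `K_H`;
* with numbers: `+ |H|·(3.8008 − 5/a)` in general (`subgroupFamily_flatWindow_floor_le`: a subgroup is
  all-even or half-even, `Σ_{χ∈H} χ(−1) ∈ {|H|, 0} ≥ 0`), `+ |H|·(5.3716 − 5/a)` when every `χ ∈ H` is even
  (`…_of_even`, `K_H` totally real; `sum_re_char_neg_one_nonneg_of_mulClosed`);
* readings: the DISCRIMINANT form `(|H| − 1) log q ≥ |H|(c − 5/a) − 16 sinh²(a/2)/a`, `c = 3.8008` /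
  `5.3716` — Odlyzko's GRH shapes `(1/n)log|d_K| ≥ log(8πe^γ)` (complex) / `log(8πe^{γ+π/2})` (totally real)
  for `K = K_H`, `n = |H|`, `log|d_K| = Σ_{χ∈H∖1} log f_χ ≤ (|H| − 1) log q` — and the SPLIT-PRIME form
  `Σ_{log n<2a, n∈H^⊥} Λ(n)n^{-1/2}(1 − log n/(2a)) ≤ [(|H| − 1) log q + 16 sinh²(a/2)/a]/(2|H|) − (c − 5/a)/2`
  (one-sided Chebotarev for the trivial class of `K_H` at square-root strength, from the rungs at ONE window).

No definitions, no named facts, RH/GRH-free (the `_of_grh` corollary takes `RH` and `GRH` as hypotheses).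

## References

* A. M. Odlyzko, *Bounds for discriminants and related estimates for class numbers, regulators and zeros
  of zeta functions: a survey of recent results*, Sém. Théor. Nombres Bordeaux 2 (1990) 119–141.
  [Odlyzko1990Bounds]
* J.-P. Serre, *Minorations de discriminants* (note, October 1975), Œuvres III, no. 106. [Serre1975Minorations]
* A. Weil, *Sur les "formules explicites" de la théorie des nombres premiers* (1952), (11) pp. 261–262.
  [Weil1952FormulesExplicites]
-/

set_option autoImplicit false

noncomputable section

open Complex Filter Set MeasureTheory
open scoped Real Topology ComplexConjugate ArithmeticFunction.vonMangoldt

namespace Summit.Ventures.WeilGRH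

open Literature.NumberTheory.LFunctions

variable {q : ℕ} {a : ℝ}

/-! ## Orthogonality over a subgroup of characters -/

/-- **Orthogonality for a multiplicatively closed finite set of characters** (a subgroup `H`):
`Σ_{χ∈H} χ(x) = |H|` if `χ(x) = 1` for every `χ ∈ H`, and `= 0` otherwise (translation by a `χ₀ ∈ H` with
`χ₀(x) ≠ 1` permutes `H`). -/
theorem sum_char_eq_of_mulClosed {s : Finset (DirichletCharacter ℂ q)}
    (hmul : ∀ χ ∈ s, ∀ ψ ∈ s, χ * ψ ∈ s) (x : ZMod q) :
    ∑ χ ∈ s, χ x = if ∀ χ ∈ s, χ x = 1 then (s.card : ℂ) else 0 := by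
  classical
  split_ifs with h
  · rw [Finset.sum_congr rfl fun χ hχ ↦ h χ hχ, Finset.sum_const, nsmul_eq_mul, mul_one]
  · push Not at h
    obtain ⟨χ₀, hχ₀, hne⟩ := h
    have himg : s.image (fun χ ↦ χ₀ * χ) = s := by
      apply Finset.eq_of_subset_of_card_le
      · intro ψ hψ
        obtain ⟨χ, hχ, rfl⟩ := Finset.mem_image.1 hψ
        exact hmul χ₀ hχ₀ χ hχ
      · rw [Finset.card_image_of_injective _ (mul_right_injective χ₀)]
    have hsum : ∑ χ ∈ s, χ x = χ₀ x * ∑ χ ∈ s, χ x := by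
      conv_lhs => rw [← himg]
      rw [Finset.sum_image fun χ _ ψ _ h ↦ mul_right_injective χ₀ h, Finset.mul_sum]
      exact Finset.sum_congr rfl fun χ _ ↦ MulChar.mul_apply χ₀ χ x
    have h0 : (χ₀ x - 1) * ∑ χ ∈ s, χ x = 0 := by rw [sub_mul, one_mul, ← hsum, sub_self]
    rcases mul_eq_zero.1 h0 with h1 | h1
    · exact absurd (sub_eq_zero.1 h1) hne
    · exact h1

/-- Real part of the subgroup orthogonality. -/
theorem re_sum_char_eq_of_mulClosed {s : Finset (DirichletCharacter ℂ q)}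
    (hmul : ∀ χ ∈ s, ∀ ψ ∈ s, χ * ψ ∈ s) (x : ZMod q) :
    (∑ χ ∈ s, χ x).re = if ∀ χ ∈ s, χ x = 1 then (s.card : ℝ) else 0 := by
  classical
  rw [sum_char_eq_of_mulClosed hmul]
  split_ifs <;> simp

/-- A subgroup of characters is ALL-EVEN or HALF-EVEN: `Σ_{χ∈H} Re χ(−1) = |H|` if every `χ ∈ H` is
even and `= 0` otherwise (orthogonality at `x = −1`); in particular `Σ_{χ∈H} Re χ(−1) ≥ 0`. -/
theorem sum_re_char_neg_one_nonneg_of_mulClosed {s : Finset (DirichletCharacter ℂ q)}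
    (hmul : ∀ χ ∈ s, ∀ ψ ∈ s, χ * ψ ∈ s) :
    0 ≤ ∑ χ ∈ s, (χ (-1)).re := by
  classical
  rw [← Complex.re_sum, re_sum_char_eq_of_mulClosed hmul]
  split_ifs
  · exact Nat.cast_nonneg _
  · exact le_rfl

/-! ## The slots over the subgroup -/

/-- **Every slot of the subgroup.**  Under the subgroup hypothesis (`ζ` rung + a rung for every
non-principal `χ ∈ H`) each `χ ∈ H` satisfies the flat-window inequality with right-hand side
`16 sinh²(a/2)/a` (`χ = 1`) or `log q`. -/
theorem flatWindow_le_slot_of_mem [NeZero q] (hq : q ≠ 1) (ha : 0 < a) {s : Finset (DirichletCharacter ℂ q)}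
    (hζ : WeilPositivityOn a) (hχ : ∀ χ ∈ s, χ ≠ 1 → WeilPositivityOnChar χ a)
    {χ : DirichletCharacter ℂ q} (hmem : χ ∈ s) :
    2 * (∑ n ∈ weilPrimeIndex a, (Λ n : ℝ) / Real.sqrt n *
          ((1 - Real.log n / (2 * a)) * (χ (n : ZMod q)).re)) +
        (Real.log (4 * π) + Real.eulerMascheroniConstant +
          2 * ∫ t in Ioi (0 : ℝ), weilKillingDensityPar (charParity χ) t) -
        1 / a * ∫ t in Ioi (0 : ℝ), weilArchDensityPar (charParity χ) t * min t (2 * a) ≤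
      if χ = 1 then 16 * Real.sinh (a / 2) ^ 2 / a else Real.log q := by
  split_ifs with h1
  · subst h1
    exact principal_flatWindow_le_of_weilPositivityOn ha hζ
  · exact flatWindow_le_log_of_weilPositivityOnChar hq χ ha (hχ χ hmem h1)

/-! ## The subgroup family inequality -/

/-- **THE SUBGROUP-FAMILY FLAT-WINDOW INEQUALITY.**  Let `q ≠ 1`, `a > 0`, and `H` (`= s`) a finite set
of Dirichlet characters mod `q` containing `1` and closed under multiplication.  If `WeilPositivityOn a`
and `WeilPositivityOnChar χ a` for every `χ ∈ H ∖ {1}`, then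

  `2|H| · Σ_{log n<2a, χ(n)=1 ∀χ∈H} Λ(n) n^{-1/2} (1 − log n/(2a))`
    `+ Σ_{χ∈H} [K_{κ(χ)} − (1/a) I_{κ(χ)}(a)] ≤ (|H| − 1)·log q + 16 sinh²(a/2)/a`.

The prime powers in `H^⊥` — splitting completely in the abelian field `K_H` cut out by `H` — carry the
positive weight `2|H|`; all other prime powers drop out.  RH/GRH-free. -/
theorem subgroupFamily_flatWindow_le [NeZero q] (hq : q ≠ 1) (ha : 0 < a)
    {s : Finset (DirichletCharacter ℂ q)} (h1 : (1 : DirichletCharacter ℂ q) ∈ s)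
    (hmul : ∀ χ ∈ s, ∀ ψ ∈ s, χ * ψ ∈ s)
    (hζ : WeilPositivityOn a) (hχ : ∀ χ ∈ s, χ ≠ 1 → WeilPositivityOnChar χ a) :
    2 * (s.card : ℝ) * (∑ n ∈ (weilPrimeIndex a).filter (fun n : ℕ ↦ ∀ χ ∈ s, χ (n : ZMod q) = 1),
          (Λ n : ℝ) / Real.sqrt n * (1 - Real.log n / (2 * a))) +
        ∑ χ ∈ s,
          ((Real.log (4 * π) + Real.eulerMascheroniConstant +
              2 * ∫ t in Ioi (0 : ℝ), weilKillingDensityPar (charParity χ) t) -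
            1 / a * ∫ t in Ioi (0 : ℝ), weilArchDensityPar (charParity χ) t * min t (2 * a)) ≤
      ((s.card : ℝ) - 1) * Real.log q + 16 * Real.sinh (a / 2) ^ 2 / a := by
  classical
  set c : ℕ → ℝ := fun n ↦ (Λ n : ℝ) / Real.sqrt n * (1 - Real.log n / (2 * a)) with hc
  set K : DirichletCharacter ℂ q → ℝ := fun χ ↦
    (Real.log (4 * π) + Real.eulerMascheroniConstant +
        2 * ∫ t in Ioi (0 : ℝ), weilKillingDensityPar (charParity χ) t) -
      1 / a * ∫ t in Ioi (0 : ℝ), weilArchDensityPar (charParity χ) t * min t (2 * a) with hK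
  set B : DirichletCharacter ℂ q → ℝ := fun χ ↦
    if χ = 1 then 16 * Real.sinh (a / 2) ^ 2 / a else Real.log q with hB
  have hslot : ∀ χ ∈ s, 2 * (∑ n ∈ weilPrimeIndex a, c n * (χ (n : ZMod q)).re) + K χ ≤ B χ := by
    intro χ hmem
    have h := flatWindow_le_slot_of_mem hq ha hζ hχ hmem
    have hs : ∑ n ∈ weilPrimeIndex a, c n * (χ (n : ZMod q)).re =
        ∑ n ∈ weilPrimeIndex a, (Λ n : ℝ) / Real.sqrt n *
          ((1 - Real.log n / (2 * a)) * (χ (n : ZMod q)).re) :=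
      Finset.sum_congr rfl fun n _ ↦ by simp only [hc]; ring
    rw [hs]
    simpa only [hK, hB, add_sub_assoc'] using h
  have hsumB : ∑ χ ∈ s, B χ = ((s.card : ℝ) - 1) * Real.log q + 16 * Real.sinh (a / 2) ^ 2 / a := by
    have hB' : ∀ χ : DirichletCharacter ℂ q,
        B χ = Real.log q + if χ = 1 then 16 * Real.sinh (a / 2) ^ 2 / a - Real.log q else 0 := by
      intro χ
      simp only [hB]
      split_ifs <;> ring
    simp_rw [hB']
    rw [Finset.sum_add_distrib, Finset.sum_const, Finset.sum_ite_eq' s (1 : DirichletCharacter ℂ q),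
      if_pos h1, nsmul_eq_mul]
    ring
  have hsumP : ∑ χ ∈ s, ∑ n ∈ weilPrimeIndex a, c n * (χ (n : ZMod q)).re =
      (s.card : ℝ) * ∑ n ∈ (weilPrimeIndex a).filter (fun n : ℕ ↦ ∀ χ ∈ s, χ (n : ZMod q) = 1), c n := by
    rw [Finset.sum_comm]
    have hin : ∀ n ∈ weilPrimeIndex a,
        ∑ χ ∈ s, c n * (χ (n : ZMod q)).re =
          if (∀ χ ∈ s, χ (n : ZMod q) = 1) then (s.card : ℝ) * c n else 0 := by
      intro n _
      rw [← Finset.mul_sum, ← Complex.re_sum, re_sum_char_eq_of_mulClosed hmul]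
      split_ifs <;> ring
    rw [Finset.sum_congr rfl hin, ← Finset.sum_filter, ← Finset.mul_sum]
  have htot := Finset.sum_le_sum hslot
  rw [Finset.sum_add_distrib, ← Finset.mul_sum, hsumP, hsumB] at htot
  linarith

/-! ## With numbers -/

/-- **THE SUBGROUP FAMILY WITH NUMBERS** (`q ≠ 1`, `a > 0`, `H ∋ 1` multiplicatively closed): under the
subgroup hypothesis,
`2|H|·Σ_{log n<2a, n∈H^⊥} Λ(n)n^{-1/2}(1 − log n/(2a)) + |H|·(3.8008 − 5/a) ≤ (|H| − 1) log q + 16 sinh²(a/2)/a`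
(`K_{κ(χ)} − I_{κ(χ)}(a)/a ≥ c(χ) − 5/a`, `c = 5.3716` even / `2.23` odd, and `Σ_{χ∈H} c(χ) ≥ 3.8008·|H|`
because a subgroup is all-even or exactly half-even).  `3.8008 ≈ log(8πe^γ)`: Odlyzko's GRH constant for
the field `K_H` when it is totally complex. -/
theorem subgroupFamily_flatWindow_floor_le [NeZero q] (hq : q ≠ 1) (ha : 0 < a)
    {s : Finset (DirichletCharacter ℂ q)} (h1 : (1 : DirichletCharacter ℂ q) ∈ s)
    (hmul : ∀ χ ∈ s, ∀ ψ ∈ s, χ * ψ ∈ s)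
    (hζ : WeilPositivityOn a) (hχ : ∀ χ ∈ s, χ ≠ 1 → WeilPositivityOnChar χ a) :
    2 * (s.card : ℝ) * (∑ n ∈ (weilPrimeIndex a).filter (fun n : ℕ ↦ ∀ χ ∈ s, χ (n : ZMod q) = 1),
          (Λ n : ℝ) / Real.sqrt n * (1 - Real.log n / (2 * a))) +
        (s.card : ℝ) * (3.8008 - 5 / a) ≤
      ((s.card : ℝ) - 1) * Real.log q + 16 * Real.sinh (a / 2) ^ 2 / a := by
  classical
  have h := subgroupFamily_flatWindow_le hq ha h1 hmul hζ hχ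
  -- per character: K − I/a ≥ (3.8008 + 1.5708 Re χ(−1)) − 5/a
  have hc : ∀ χ : DirichletCharacter ℂ q,
      (if χ.Even then (5.3716 : ℝ) else 2.23) = 3.8008 + 1.5708 * (χ (-1)).re := by
    intro χ
    rcases χ.even_or_odd with he | ho
    · rw [if_pos he, show χ (-1) = 1 from he]; norm_num
    · rw [if_neg ho.not_even, show χ (-1) = -1 from ho]; norm_num
  have hlow : ∑ χ ∈ s, ((3.8008 + 1.5708 * (χ (-1)).re) - 5 / a) ≤
      ∑ χ ∈ s,
        ((Real.log (4 * π) + Real.eulerMascheroniConstant +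
            2 * ∫ t in Ioi (0 : ℝ), weilKillingDensityPar (charParity χ) t) -
          1 / a * ∫ t in Ioi (0 : ℝ), weilArchDensityPar (charParity χ) t * min t (2 * a)) :=
    Finset.sum_le_sum fun χ _ ↦ by rw [← hc χ]; exact flatWindow_archConst_ge ha χ
  rw [Finset.sum_sub_distrib, Finset.sum_add_distrib, Finset.sum_const, Finset.sum_const, nsmul_eq_mul,
    nsmul_eq_mul, ← Finset.mul_sum] at hlow
  have hpar := sum_re_char_neg_one_nonneg_of_mulClosed hmul
  linarith

/-- **The totally real case**: if every `χ ∈ H` is even (`K_H` totally real), the constant improves to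
`5.3716 ≈ log(8πe^{γ+π/2})`, Odlyzko's GRH constant for totally real fields:
`2|H|·Σ_{n∈H^⊥} … + |H|·(5.3716 − 5/a) ≤ (|H| − 1) log q + 16 sinh²(a/2)/a`. -/
theorem subgroupFamily_flatWindow_floor_le_of_even [NeZero q] (hq : q ≠ 1) (ha : 0 < a)
    {s : Finset (DirichletCharacter ℂ q)} (h1 : (1 : DirichletCharacter ℂ q) ∈ s)
    (hmul : ∀ χ ∈ s, ∀ ψ ∈ s, χ * ψ ∈ s) (hev : ∀ χ ∈ s, χ.Even)
    (hζ : WeilPositivityOn a) (hχ : ∀ χ ∈ s, χ ≠ 1 → WeilPositivityOnChar χ a) :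
    2 * (s.card : ℝ) * (∑ n ∈ (weilPrimeIndex a).filter (fun n : ℕ ↦ ∀ χ ∈ s, χ (n : ZMod q) = 1),
          (Λ n : ℝ) / Real.sqrt n * (1 - Real.log n / (2 * a))) +
        (s.card : ℝ) * (5.3716 - 5 / a) ≤
      ((s.card : ℝ) - 1) * Real.log q + 16 * Real.sinh (a / 2) ^ 2 / a := by
  classical
  have h := subgroupFamily_flatWindow_le hq ha h1 hmul hζ hχ
  have hlow : ∑ χ ∈ s, ((5.3716 : ℝ) - 5 / a) ≤
      ∑ χ ∈ s,
        ((Real.log (4 * π) + Real.eulerMascheroniConstant +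
            2 * ∫ t in Ioi (0 : ℝ), weilKillingDensityPar (charParity χ) t) -
          1 / a * ∫ t in Ioi (0 : ℝ), weilArchDensityPar (charParity χ) t * min t (2 * a)) :=
    Finset.sum_le_sum fun χ hmem ↦ by
      have h' := flatWindow_archConst_ge ha χ
      rwa [if_pos (hev χ hmem)] at h'
  rw [Finset.sum_const, nsmul_eq_mul] at hlow
  linarith

/-! ## Readings: discriminant and split primes of `K_H` -/

/-- **DISCRIMINANT FORM for the subgroup** (`K_H` arbitrary abelian of conductor `∣ q`): under the subgroup
hypothesis, `|H|·(3.8008 − 5/a) − 16 sinh²(a/2)/a ≤ (|H| − 1)·log q` — Odlyzko's GRH shape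
`(1/n) log|d_{K_H}| ≥ log(8πe^γ) − O(1/a) − pole/n` (`n = |H|`, `log|d_{K_H}| = Σ_{χ∈H∖1} log f_χ ≤ (|H|−1) log q`)
from the rungs at one window.  RH/GRH-free. -/
theorem log_level_ge_of_subgroupFamily [NeZero q] (hq : q ≠ 1) (ha : 0 < a)
    {s : Finset (DirichletCharacter ℂ q)} (h1 : (1 : DirichletCharacter ℂ q) ∈ s)
    (hmul : ∀ χ ∈ s, ∀ ψ ∈ s, χ * ψ ∈ s)
    (hζ : WeilPositivityOn a) (hχ : ∀ χ ∈ s, χ ≠ 1 → WeilPositivityOnChar χ a) :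
    (s.card : ℝ) * (3.8008 - 5 / a) - 16 * Real.sinh (a / 2) ^ 2 / a ≤ ((s.card : ℝ) - 1) * Real.log q := by
  classical
  have h := subgroupFamily_flatWindow_floor_le hq ha h1 hmul hζ hχ
  have hS : 0 ≤ ∑ n ∈ (weilPrimeIndex a).filter (fun n : ℕ ↦ ∀ χ ∈ s, χ (n : ZMod q) = 1),
      (Λ n : ℝ) / Real.sqrt n * (1 - Real.log n / (2 * a)) :=
    Finset.sum_nonneg fun n hn ↦ flatSum_term_nonneg ha (Finset.mem_of_mem_filter n hn)
  have hcard : (0 : ℝ) ≤ s.card := Nat.cast_nonneg _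
  nlinarith

/-- **SPLIT PRIMES OF `K_H` FROM POSITIVITY** (one-sided Chebotarev for the trivial class at square-root
strength): under the subgroup hypothesis,
`Σ_{log n<2a, χ(n)=1 ∀χ∈H} Λ(n)n^{-1/2}(1 − log n/(2a)) ≤ [(|H| − 1) log q + 16 sinh²(a/2)/a]/(2|H|) − (3.8008 − 5/a)/2`
— the square-root main term `4(√x − 2 + x^{-1/2})/(|H| log x)` (`x = e^{2a}`) is the `ζ` count divided by
the degree `|H| = [K_H : ℚ]`, plus `(1 − 1/|H|)(log q)/2`. -/
theorem splitPrimes_flatSum_le_of_subgroupFamily [NeZero q] (hq : q ≠ 1) (ha : 0 < a)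
    {s : Finset (DirichletCharacter ℂ q)} (h1 : (1 : DirichletCharacter ℂ q) ∈ s)
    (hmul : ∀ χ ∈ s, ∀ ψ ∈ s, χ * ψ ∈ s)
    (hζ : WeilPositivityOn a) (hχ : ∀ χ ∈ s, χ ≠ 1 → WeilPositivityOnChar χ a) :
    ∑ n ∈ (weilPrimeIndex a).filter (fun n : ℕ ↦ ∀ χ ∈ s, χ (n : ZMod q) = 1),
        (Λ n : ℝ) / Real.sqrt n * (1 - Real.log n / (2 * a)) ≤
      (((s.card : ℝ) - 1) * Real.log q + 16 * Real.sinh (a / 2) ^ 2 / a) / (2 * s.card) -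
        (3.8008 - 5 / a) / 2 := by
  classical
  have h := subgroupFamily_flatWindow_floor_le hq ha h1 hmul hζ hχ
  have hcard : (0 : ℝ) < s.card := by exact_mod_cast Finset.card_pos.2 ⟨1, h1⟩
  rw [le_sub_iff_add_le, le_div_iff₀ (by positivity)]
  nlinarith

/-- **Under `RH` + `GRH` for the characters of a prime modulus**: every subgroup `H ∋ 1` of characters mod
`p` and every window `a > 0` satisfy the subgroup family inequality with numbers. -/
theorem subgroupFamily_flatWindow_floor_le_of_grh {p : ℕ} [NeZero p] (hp : p.Prime)
    (hRH : RiemannHypothesis) (hGRH : ∀ χ : DirichletCharacter ℂ p, χ ≠ 1 → χ.RiemannHypothesis)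
    (ha : 0 < a) {s : Finset (DirichletCharacter ℂ p)} (h1 : (1 : DirichletCharacter ℂ p) ∈ s)
    (hmul : ∀ χ ∈ s, ∀ ψ ∈ s, χ * ψ ∈ s) :
    2 * (s.card : ℝ) * (∑ n ∈ (weilPrimeIndex a).filter (fun n : ℕ ↦ ∀ χ ∈ s, χ (n : ZMod p) = 1),
          (Λ n : ℝ) / Real.sqrt n * (1 - Real.log n / (2 * a))) +
        (s.card : ℝ) * (3.8008 - 5 / a) ≤
      ((s.card : ℝ) - 1) * Real.log p + 16 * Real.sinh (a / 2) ^ 2 / a := by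
  have hp1 : p ≠ 1 := hp.ne_one
  refine subgroupFamily_flatWindow_floor_le hp1 ha h1 hmul
    (riemannHypothesis_iff_forall_weilPositivityOn.1 hRH a ha) fun χ _ hχ ↦ ?_
  have hprim : χ.IsPrimitive := by
    rw [DirichletCharacter.isPrimitive_def]
    rcases (Nat.dvd_prime hp).1 χ.conductor_dvd_level with h | h
    · exact absurd (DirichletCharacter.eq_one_iff_conductor_eq_one.2 h) hχ
    · exact h
  exact (WeilPositivityChar.of_grh hp1 hprim (hGRH χ hχ)).on a

end Summit.Ventures.WeilGRH

end
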